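import Summits.QuantumFields.YangMills.Theorems.BalabanUVNodesK0RecordFormatNamesFluctEk
import HarnessLib

/-!
# [I] (0.22)∕(0.23) UNFOLDED AT THE CHART POINT — `recordEkChart` (DEF-1 ✓p827012, socket (o4-a)) read as `A_k − A⁰_k` and, ON A DOMAIN, as the (0.23) sum over `j < k`
# (brick row (o4-b) of ▶ PT-A's `EK-CHART-BRICKS-v1.md` b0872ae801a4fced; ★★★ director-ym №591 (2) docket of porter lineage `ymgap-nodeO-port-PTB-1`, gen 9)

Cell `pub-ymgap` ∕ `ym-nodeO-ideate` ∕ `ym-balaban-port`, porter PT-B (gen 9).  `--kind proof --supports stmt-QuantumFields-27930 --as helper`; count-neutral.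
[I] = [Balaban1987RG1] = T. Bałaban, *Renormalization group approach to lattice gauge field theories. I*, Commun. Math. Phys. **109** (1987) 249–301.

THE PRINT.  (0.22) p.256: «A_k(V) = −(1∕g_k²)A^η(U_k(V)) + 𝐄_k(V)»; (0.23) p.256: «𝐄_k(V) = Σ_{j=0}^{k−1} [ −β_{j+1}·A^η(U_k(V)) + 𝓝_{j+1}(Ū^{j+1}(U_k(V))) ]»
(the MERGED TERM `𝓝_{j+1}` of (1.6) p.261); (2.4) p.266: the chart `V = V′V^{(k)}`, `V′ = exp(iB′)`; (2.12)–(2.13) p.268: the curly bracket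
«{𝐄_k(U_k(exp i[…]V^{(k)})) − 𝐄_k(U_k(V^{(k)}))}» inside the fluctuation integral.

WHAT THIS FILE PROVES (0 def; bookkeeping — definition chasing, `ring`, `Finset.sum_sub_distrib`):
§1 (0.22) at the chart point `pert F k K (portVkAx F a₀ ε₂₉ k K B) x` (coupling `extd v k = v (Fin.last k)` inline from lit ✓`T4FlagMemory.extd_coe` — the same one-liner as ✓`BalabanUVNodesN26ChiStep.extd_apply_last`, whose module has no farm olean today, so it is not imported): `recordEkChart_unfold` (`rfl` to lit's `ZeroInput.EkT`), ★ `effActionHT_chart_eq_main_add_recordEkChart`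
   (`A_k = A⁰_k + 𝐄_k` at the chart point, lit ✓`ZeroInput.effActionHT_eq_main_add_Ek`), ★ `effActionHT_chart_eq_repr022` (the first clause of lit's `ReprAOfRecordT` VERBATIM, coupling
   `v (Fin.last k)`), `recordEkBracket_eq_effAction_sub` (the bracket as «(A_k − A⁰_k)(x) − (A_k − A⁰_k)(0)»).
§2 (0.23): `reprAOfRecordT_EkT_iff` — for `A := effActionHT …`, `W := A^η ∘ U_k`, `E := EkT …` the format predicate `ReprAOfRecordT` IS its (0.23) clause (the (0.22) clause holds by
   `ring`); ★★ `recordEkChart_eq_sum023_of_repr` — ON `dom`, from a DISPLAYED `ReprAOfRecordT` hypothesis at level `k` (history currency `hist := v`, `E := EkT …`, ANY `A`, `W`), the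
   chart-read `𝐄_k` IS the (0.23) sum; ★★ `recordEkBracket_eq_sum023_of_repr` — the curly bracket as `Σ_{j<k} [ −β_j·(W(V′V^{(k)}) − W(V^{(k)})) + (𝓝_{j+1}(…V′V^{(k)}) − 𝓝_{j+1}(…V^{(k)})) ]`
   when both chart points lie in `dom`.
HONEST FRAMING.  Bookkeeping only: (0.23) is NOT proved here — it enters as the displayed hypothesis `ReprAOfRecordT …` (lit reduces it to `HCompT`∕`HOrbit`∕`HInvT` + the flow recursion,
✓`Node00.reprAOfRecordT_atRecord`-class; the induction of [I] §§3–5 = ⟨27930⟩ at lower levels, row (o4-e), NOT mine); (o4-c) (the minimiser in the chart) and (o4-d) are NOT here.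
NOTHING of Bałaban is asserted, ported or discharged; `recordFluctInt` NOT in the tree; `stub_P0C`∕`stub_FE` OPEN, ⟨stmt-QuantumFields-27930⟩ OPEN (1∕3); K0ᴬ∕K1ᴬ∕K3ᴬ 0∕3; NODE O 0∕1;
COUNT 8∕28 · K 1∕4 UNMOVED; finite `𝕋⁴_{L^K}` at fixed ε — NOT continuum ∕ ℝ⁴ ∕ OS; **the Yang–Mills mass gap (Clay) is NOT proved by any of this.**  No `sorry`, `instance`, `notation`,
`set_option`; standard axioms.
-/

noncomputable section

open scoped BigOperators

namespace Summit.QuantumFields.YangMills.Theorems.BalabanUVNodesPortS1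

open Summit.QuantumFields.YangMills.Theorems.K0RecordFormatNames
open Literature.MathematicalPhysics.QuantumFieldTheory.Balaban1983to89
open Literature.MathematicalPhysics.QuantumFieldTheory.Balaban1983to89.Node00
open Literature.MathematicalPhysics.QuantumFieldTheory.Balaban1983to89.T4Continuum (T4Family)
open Literature.MathematicalPhysics.QuantumFieldTheory.Balaban1983to89.T4FlagMemory (extd extd_coe)
open Literature.MathematicalPhysics.QuantumFieldTheory.Balaban1983to89.FlowStep (HBeta prefixOf)

variable (F : T4Family)

/-! ## §1  (0.22) at the chart point -/

section Eq022

/-- (0.22) AS A DEFINITION, UNFOLDED AT THE CHART POINT: `recordEkChart … B x = A_k(V′V^{(k)}) + (1∕g_k²)·A^η(U_k(V′V^{(k)}))` with `A_k = effActionHT …` over the record's transport∕cut-off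
tokens, the history `extd v`, `U_k = Uk F 2 K k θ.εbg` (`rfl` to lit ✓`ZeroInput.EkT`). [cite: Balaban1987RG1, (0.22) p.256, (2.4) p.266] -/
theorem recordEkChart_unfold (a₀ ε₂₉ : ℝ) (k : ℕ) (v : Fin (k + 1) → ℝ) (K : ℕ) (B : recordW F a₀ ε₂₉ k K) (x : FluctIdx F k K → ℝ) :
    recordEkChart F a₀ ε₂₉ k v K B x =
      effActionHT F 2 (TβOfRecord₁₃ F 2) (chiβOfRecord₁₃Ax F 2 (thetaFill F a₀ ε₂₉)) K (extd v) k (pert F k K (portVkAx F a₀ ε₂₉ k K B) x)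
        + (1 / (extd v k) ^ 2) * wilsonAction4 (Uk F 2 K k (thetaFill F a₀ ε₂₉).εbg (pert F k K (portVkAx F a₀ ε₂₉ k K B) x)) := rfl

/-- ★ **`A_k = A⁰_k + 𝐄_k` AT THE CHART POINT** — THE TREE's (0.22) split (lit ✓`ZeroInput.effActionHT_eq_main_add_Ek`) read at `V′V^{(k)}_{ax}(W_B)`:
`A_k(pert … x) = A⁰_k(pert … x) + recordEkChart … B x`, `A⁰_k = −(1∕g_k²)A^η(U_k ·)` (`ZeroInput.mainTermT`). [cite: Balaban1987RG1, (0.22) p.256, (1.3) p.260, (2.4) p.266] -/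
theorem effActionHT_chart_eq_main_add_recordEkChart (a₀ ε₂₉ : ℝ) (k : ℕ) (v : Fin (k + 1) → ℝ) (K : ℕ) (B : recordW F a₀ ε₂₉ k K) (x : FluctIdx F k K → ℝ) :
    effActionHT F 2 (TβOfRecord₁₃ F 2) (chiβOfRecord₁₃Ax F 2 (thetaFill F a₀ ε₂₉)) K (extd v) k (pert F k K (portVkAx F a₀ ε₂₉ k K B) x) =
      ZeroInput.mainTermT F 2 (thetaFill F a₀ ε₂₉).εbg K (extd v) k (pert F k K (portVkAx F a₀ ε₂₉ k K B) x) + recordEkChart F a₀ ε₂₉ k v K B x :=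
  ZeroInput.effActionHT_eq_main_add_Ek F 2 _ _ _ K (extd v) k _

/-- The same solved for `𝐄_k`: `recordEkChart … B x = A_k(V′V^{(k)}) − A⁰_k(V′V^{(k)})`. [cite: Balaban1987RG1, (0.22) p.256, (1.3) p.260] -/
theorem recordEkChart_eq_effAction_sub_main (a₀ ε₂₉ : ℝ) (k : ℕ) (v : Fin (k + 1) → ℝ) (K : ℕ) (B : recordW F a₀ ε₂₉ k K) (x : FluctIdx F k K → ℝ) :
    recordEkChart F a₀ ε₂₉ k v K B x =
      effActionHT F 2 (TβOfRecord₁₃ F 2) (chiβOfRecord₁₃Ax F 2 (thetaFill F a₀ ε₂₉)) K (extd v) k (pert F k K (portVkAx F a₀ ε₂₉ k K B) x)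
        - ZeroInput.mainTermT F 2 (thetaFill F a₀ ε₂₉).εbg K (extd v) k (pert F k K (portVkAx F a₀ ε₂₉ k K B) x) := by
  rw [effActionHT_chart_eq_main_add_recordEkChart]; ring

/-- ★ **(0.22) VERBATIM AT THE CHART POINT, IN THE SHAPE OF lit's `ReprAOfRecordT` (first clause, coupling `g_k = v (Fin.last k)`)**:
`A_k(V′V^{(k)}) = −(1∕(v_k)²)·A^η(U_k(V′V^{(k)})) + recordEkChart … B x`. [cite: Balaban1987RG1, (0.22) p.256, (2.4) p.266] -/
theorem effActionHT_chart_eq_repr022 (a₀ ε₂₉ : ℝ) (k : ℕ) (v : Fin (k + 1) → ℝ) (K : ℕ) (B : recordW F a₀ ε₂₉ k K) (x : FluctIdx F k K → ℝ) :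
    effActionHT F 2 (TβOfRecord₁₃ F 2) (chiβOfRecord₁₃Ax F 2 (thetaFill F a₀ ε₂₉)) K (extd v) k (pert F k K (portVkAx F a₀ ε₂₉ k K B) x) =
      -(1 / (v (Fin.last k)) ^ 2) * wilsonAction4 (Uk F 2 K k (thetaFill F a₀ ε₂₉).εbg (pert F k K (portVkAx F a₀ ε₂₉ k K B) x))
        + recordEkChart F a₀ ε₂₉ k v K B x := by
  rw [recordEkChart_unfold, show extd v k = v (Fin.last k) by simpa using extd_coe v (Fin.last k)]; ring

/-- PRINT's CURLY BRACKET as «(A_k − A⁰_k)(V′V^{(k)}) − (A_k − A⁰_k)(V^{(k)})» (✓`recordEkBracket_eq` + ✓`pert_zero`). [cite: Balaban1987RG1, (2.12)–(2.13) p.268, (0.22) p.256] -/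
theorem recordEkBracket_eq_effAction_sub (a₀ ε₂₉ : ℝ) (k : ℕ) (v : Fin (k + 1) → ℝ) (K : ℕ) (B : recordW F a₀ ε₂₉ k K) (x : FluctIdx F k K → ℝ) :
    recordEkBracket F a₀ ε₂₉ k v K B x =
      (effActionHT F 2 (TβOfRecord₁₃ F 2) (chiβOfRecord₁₃Ax F 2 (thetaFill F a₀ ε₂₉)) K (extd v) k (pert F k K (portVkAx F a₀ ε₂₉ k K B) x)
          - ZeroInput.mainTermT F 2 (thetaFill F a₀ ε₂₉).εbg K (extd v) k (pert F k K (portVkAx F a₀ ε₂₉ k K B) x))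
        - (effActionHT F 2 (TβOfRecord₁₃ F 2) (chiβOfRecord₁₃Ax F 2 (thetaFill F a₀ ε₂₉)) K (extd v) k (portVkAx F a₀ ε₂₉ k K B)
          - ZeroInput.mainTermT F 2 (thetaFill F a₀ ε₂₉).εbg K (extd v) k (portVkAx F a₀ ε₂₉ k K B)) := by
  rw [recordEkBracket_eq, recordEkChart_eq_effAction_sub_main, recordEkChart_eq_effAction_sub_main, pert_zero]

end Eq022

/-! ## §2  (0.23) on a domain, from the displayed format predicate at level `k` -/

section Eq023

/-- For `A := A_k = effActionHT …`, `W := A^η ∘ U_k`, `E := 𝐄_k = EkT …` (history currency `g := extd hist`) lit's format predicate `ReprAOfRecordT` IS its (0.23) clause: the (0.22) clause holds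
by `ring` (`extd v k = v (Fin.last k)`, lit ✓`extd_coe`). Generic transport `T`, cut-offs `χ`, radius `ε`. [cite: Balaban1987RG1, (0.22)–(0.23) p.256] -/
theorem reprAOfRecordT_EkT_iff (T : Transport F 2) (χ : (K : ℕ) → (ℕ → ℝ) → (k : ℕ) → Density (F.P K) k (SU 2)) (ε : ℝ) (β : HBeta) (p : B12.RunParams) (k : ℕ)
    (hist : Fin (k + 1) → ℝ) (dom : Set (GaugeField (F.P p.K) k (SU 2))) :
    ReprAOfRecordT F 2 T χ ε β p k hist dom (effActionHT F 2 T χ p.K (extd hist) k) (fun V => wilsonAction4 (Uk F 2 p.K k ε V)) (ZeroInput.EkT F 2 T χ ε p.K (extd hist) k) ↔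
      ∀ V ∈ dom, ZeroInput.EkT F 2 T χ ε p.K (extd hist) k V = ∑ j ∈ Finset.range k,
        (-(β j (prefixOf (extd hist) j)) * wilsonAction4 (Uk F 2 p.K k ε V)
          + mergedTermT F 2 T χ ε p.K (extd hist) j (Averaging.iter (avOfRecord F 2 p.K) (j + 1) (Uk F 2 p.K k ε V))) := by
  refine ⟨fun h => h.2, fun h => ⟨fun V _ => ?_, h⟩⟩
  rw [ZeroInput.effActionHT_eq_main_add_Ek F 2 T χ ε p.K (extd hist) k V, ← show extd hist k = hist (Fin.last k) by simpa using extd_coe hist (Fin.last k)]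
  unfold ZeroInput.mainTermT
  ring

/-- ★★ **(0.23) AT THE CHART POINT, ON THE DOMAIN**: if the format predicate `ReprAOfRecordT` holds at level `k` on `dom` with `E := 𝐄_k = EkT …` over the record's tokens and the history
`v` (ANY `A`, `W` — print's are `A_k`, `A^η ∘ U_k`), then at every chart point `V′V^{(k)}_{ax}(W_B) = pert … x ∈ dom`:
`recordEkChart … B x = Σ_{j<k} [ −β_j(g_0,…,g_j)·W(V′V^{(k)}) + 𝓝_{j+1}(Ū^{j+1}(U_k(V′V^{(k)}))) ]`.  The hypothesis is DISPLAYED ((0.23) = composition of minimisers + flow recursion,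
lit ✓`Node00.reprAOfRecordT_atRecord`-class; the induction of §§3–5 at lower levels is ⟨27930⟩ itself — NOT proved here). [cite: Balaban1987RG1, (0.23) p.256, (1.6) p.261, (2.4) p.266] -/
theorem recordEkChart_eq_sum023_of_repr (a₀ ε₂₉ : ℝ) (β : HBeta) (p : B12.RunParams) (k : ℕ) (v : Fin (k + 1) → ℝ)
    {dom : Set (GaugeField (F.P p.K) k (SU 2))} {A W : GaugeField (F.P p.K) k (SU 2) → ℝ}
    (hR : ReprAOfRecordT F 2 (TβOfRecord₁₃ F 2) (chiβOfRecord₁₃Ax F 2 (thetaFill F a₀ ε₂₉)) (thetaFill F a₀ ε₂₉).εbg β p k v dom A W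
      (ZeroInput.EkT F 2 (TβOfRecord₁₃ F 2) (chiβOfRecord₁₃Ax F 2 (thetaFill F a₀ ε₂₉)) (thetaFill F a₀ ε₂₉).εbg p.K (extd v) k))
    (B : recordW F a₀ ε₂₉ k p.K) {x : FluctIdx F k p.K → ℝ} (hx : pert F k p.K (portVkAx F a₀ ε₂₉ k p.K B) x ∈ dom) :
    recordEkChart F a₀ ε₂₉ k v p.K B x = ∑ j ∈ Finset.range k,
      (-(β j (prefixOf (extd v) j)) * W (pert F k p.K (portVkAx F a₀ ε₂₉ k p.K B) x)
        + mergedTermT F 2 (TβOfRecord₁₃ F 2) (chiβOfRecord₁₃Ax F 2 (thetaFill F a₀ ε₂₉)) (thetaFill F a₀ ε₂₉).εbg p.K (extd v) j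
            (Averaging.iter (avOfRecord F 2 p.K) (j + 1) (Uk F 2 p.K k (thetaFill F a₀ ε₂₉).εbg (pert F k p.K (portVkAx F a₀ ε₂₉ k p.K B) x)))) :=
  hR.2 _ hx

/-- ★★ **PRINT's CURLY BRACKET THROUGH (0.23)**: when both chart points `V′V^{(k)}` and `V^{(k)}` lie in `dom`,
`recordEkBracket … B x = Σ_{j<k} [ −β_j·(W(V′V^{(k)}) − W(V^{(k)})) + (𝓝_{j+1}(Ū^{j+1}U_k(V′V^{(k)})) − 𝓝_{j+1}(Ū^{j+1}U_k(V^{(k)}))) ]` — the form the stage-2 carrier expands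
term by term ((2.13)–(2.14)). [cite: Balaban1987RG1, (2.12)–(2.13) p.268, (0.23) p.256, (1.6) p.261] -/
theorem recordEkBracket_eq_sum023_of_repr (a₀ ε₂₉ : ℝ) (β : HBeta) (p : B12.RunParams) (k : ℕ) (v : Fin (k + 1) → ℝ)
    {dom : Set (GaugeField (F.P p.K) k (SU 2))} {A W : GaugeField (F.P p.K) k (SU 2) → ℝ}
    (hR : ReprAOfRecordT F 2 (TβOfRecord₁₃ F 2) (chiβOfRecord₁₃Ax F 2 (thetaFill F a₀ ε₂₉)) (thetaFill F a₀ ε₂₉).εbg β p k v dom A W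
      (ZeroInput.EkT F 2 (TβOfRecord₁₃ F 2) (chiβOfRecord₁₃Ax F 2 (thetaFill F a₀ ε₂₉)) (thetaFill F a₀ ε₂₉).εbg p.K (extd v) k))
    (B : recordW F a₀ ε₂₉ k p.K) {x : FluctIdx F k p.K → ℝ} (hx : pert F k p.K (portVkAx F a₀ ε₂₉ k p.K B) x ∈ dom) (h0 : portVkAx F a₀ ε₂₉ k p.K B ∈ dom) :
    recordEkBracket F a₀ ε₂₉ k v p.K B x = ∑ j ∈ Finset.range k,
      (-(β j (prefixOf (extd v) j)) * (W (pert F k p.K (portVkAx F a₀ ε₂₉ k p.K B) x) - W (portVkAx F a₀ ε₂₉ k p.K B))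
        + (mergedTermT F 2 (TβOfRecord₁₃ F 2) (chiβOfRecord₁₃Ax F 2 (thetaFill F a₀ ε₂₉)) (thetaFill F a₀ ε₂₉).εbg p.K (extd v) j
              (Averaging.iter (avOfRecord F 2 p.K) (j + 1) (Uk F 2 p.K k (thetaFill F a₀ ε₂₉).εbg (pert F k p.K (portVkAx F a₀ ε₂₉ k p.K B) x)))
          - mergedTermT F 2 (TβOfRecord₁₃ F 2) (chiβOfRecord₁₃Ax F 2 (thetaFill F a₀ ε₂₉)) (thetaFill F a₀ ε₂₉).εbg p.K (extd v) j
              (Averaging.iter (avOfRecord F 2 p.K) (j + 1) (Uk F 2 p.K k (thetaFill F a₀ ε₂₉).εbg (portVkAx F a₀ ε₂₉ k p.K B))))) := by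
  have hx0 : pert F k p.K (portVkAx F a₀ ε₂₉ k p.K B) 0 ∈ dom := by rwa [pert_zero]
  rw [recordEkBracket_eq, recordEkChart_eq_sum023_of_repr F a₀ ε₂₉ β p k v hR B hx, recordEkChart_eq_sum023_of_repr F a₀ ε₂₉ β p k v hR B hx0,
    ← Finset.sum_sub_distrib]
  refine Finset.sum_congr rfl fun j _ => ?_
  rw [pert_zero]; ring

end Eq023

end Summit.QuantumFields.YangMills.Theorems.BalabanUVNodesPortS1

end
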